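import Literature.NumberTheory.Automorphic.RankinSelbergLocalProofs
import Literature.NumberTheory.Automorphic.RankinSelbergLocalEpsilonProofs
import HarnessLib

/-!
# Proofs for `RankinSelbergLocal`: the twist `π^ι = π ∘ ᵗ(·)⁻¹` and the tilde side of the
functional equation

Topic `Literature/NumberTheory/Automorphic`; vocabulary of `RankinSelbergLocal`
(`tildeFn`, `weylLong`, `weylNM`, `whittakerFunctionals`, `whittakerModel`, `IsGeneric`,
`rsZetaTilde`, `HasRSEpsilon`, the named fact `hasRSEpsilon_ne_zero`), of `SmoothRepresentation`
(`Representation.IsSmooth`, `IsAdmissible`, `fixedPoints`, `stabilizerSubgroup`) and of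
`GaloisRepresentations.ContinuousRep` (`glTransposeInv`, the continuous involution `g ↦ ᵗg⁻¹` of
`GL_n`). A *proofs* file (theorems only, no definitions; the twist is written
`π.comp (glTransposeInv (Fin n) F).toMonoidHom` throughout). Continues
`RankinSelbergLocalEpsilonProofs` (provefact pass on `hasRSEpsilon_ne_zero`).

## Content (all proved)

* `glTransposeInv_glTransposeInv`, `glTransposeInv_weylLong` (`ι² = 1`, `ι(w_n) = w_n`),
  `comp_glTransposeInv_comp_glTransposeInv` (`(π^ι)^ι = π`), `comp_weylLong_comp_weylLong`.
* **Whittaker functionals of the twist** (Jacquet–Piatetski-Shapiro–Shalika 1983, §2 (2.1):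
  `W̃(g) = W(w_n ᵗg⁻¹)` lies in `𝒲(π̃, ψ⁻¹)`, `π̃ ≅ π^ι`; Cogdell, *Analytic theory of
  `L`-functions for `GL_n`*, §2.2): `Λ ↦ Λ ∘ π(w_n)` maps `Hom_{U_n}(π, ψ_U)` to
  `Hom_{U_n}(π^ι, ψ⁻¹_U)` and back (`comp_weylLong_mem_whittakerFunctionals_twist`,
  `comp_weylLong_mem_whittakerFunctions_of_twist`), using `ψ_U(w_n ᵗu⁻¹ w_n) = ψ⁻¹_U(u)`
  (`whittakerCharFun_weylLong_conj` of `RankinSelbergLocalProofs`); hence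
  `W̃_{Λ,v} = W^{π^ι}_{Λ∘π(w_n), v}` and `ρ(h) W̃_{Λ,v} = W^{π^ι}_{Λ∘π(w_n), π(ᵗh⁻¹) v}`
  (`tildeFn_whittakerModel`, `tildeFn_whittakerModel_mul`) — no appeal to the Gelfand–Kazhdan
  isomorphism `π̃ ≅ π^ι` is needed for these identities.
* **The twist is again irreducible / smooth / admissible / generic**
  (`isIrreducible_comp_iff`, `isIrreducible_twist_iff`, `isSmooth_twist`, `fixedPoints_twist`,
  `isAdmissible_twist`, `IsGeneric.twist`), and `ψ⁻¹` is again non-trivial continuous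
  (`AddChar.IsContinuousNontrivial.inv`).
* **Transport of the span** (`tilde_span_of_twist_span`): a combination
  `∑ Q_i Ψ_{n-m-1}(s; W_i, W'_i) = P(q^{-s})⁻¹` of `j = n - m - 1` integrals of Whittaker functions
  of `(π^ι, ψ⁻¹)`, `(π'^ι, ψ)` IS a combination of the tilde integrals `Ψ̃(s; ρ(w_{n,m}) W̃, W̃')`
  of `(π, π', ψ)` entering `HasRSGamma`. Consequently (`hasRSEpsilon_ne_zero_of_twist_span`, with
  `hasRSEpsilon_ne_zero_of_tilde_span` of `RankinSelbergLocalEpsilonProofs`) the named fact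
  `hasRSEpsilon_ne_zero` at `(μ, ν)` follows from: *for the irreducible admissible generic twists
  `π^ι`, `π'^ι` and `ψ⁻¹`, the `Ψ_{n-m-1}` integrals (at `μ`, `ν`) span a non-zero fractional
  ideal* — Jacquet–Piatetski-Shapiro–Shalika 1983, Thm. 2.7 (ii) for `j = n - m - 1` (Cogdell,
  §3.1, Thm. 3.1: "each of these fractional ideals contain 1"), the remaining analytic input
  (a theory of `p`-adic integrals of Whittaker functions, not in the tree).

## References

* H. Jacquet, I. I. Piatetski-Shapiro, J. A. Shalika, *Rankin–Selberg convolutions*, Amer. J.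
  Math. 105 (1983) 367–464, §2 (2.1), Thm. 2.7. [JacquetPiatetskiShapiroShalika1983]
* J. W. Cogdell, *Analytic theory of `L`-functions for `GL_n`*, in Bernstein–Gelbart (eds.),
  *An Introduction to the Langlands Program*, §2.2, §3.1. [CogdellAnalyticTheory2004]
-/

open Matrix MeasureTheory Polynomial
open Literature.NumberTheory.GaloisRepresentations (glTransposeInv coe_glTransposeInv_apply)
open Literature.NumberTheory.GaloisRepresentations.IsNonarchimedeanLocalField

noncomputable section

/-- The inverse `ψ⁻¹ = ψ(-·)` of a non-trivial continuous additive character is again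
non-trivial and continuous. Deliberate dot-notation extension of `AddChar.IsContinuousNontrivial`
(itself declared in Mathlib's `AddChar` namespace by `TateLocalFactors`). [folklore] -/
theorem AddChar.IsContinuousNontrivial.inv {F : Type*} [Field F] [ValuativeRel F]
    [TopologicalSpace F] [IsNonarchimedeanLocalField F] {ψ : AddChar F Circle}
    (h : ψ.IsContinuousNontrivial) : ψ⁻¹.IsContinuousNontrivial := by
  refine ⟨?_, ?_⟩
  · have : ((ψ⁻¹ : AddChar F Circle) : F → Circle) = ψ ∘ Neg.neg :=
      funext fun x => AddChar.inv_apply ψ x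
    rw [this]
    exact h.1.comp continuous_neg
  · intro h0
    apply h.2
    have : ψ = ψ⁻¹⁻¹ := (inv_inv ψ).symm
    rw [this, h0]
    rfl

namespace Literature.NumberTheory.Automorphic

/-! ### Irreducibility under a surjective reparametrisation -/

section IrredComp

/-- Irreducibility is insensitive to a surjective reparametrisation of the group: `ρ ∘ f` and
`ρ` have the same stable subspaces (`f : H →* G` surjective; Mathlib's
`Representation.IsIrreducible` = `IsSimpleOrder (Subrepresentation _)`). [folklore] -/
theorem isIrreducible_comp_iff {k G H V : Type*} [Field k] [Monoid G] [Monoid H]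
    [AddCommGroup V] [Module k V] (ρ : Representation k G V) (f : H →* G)
    (hf : Function.Surjective f) :
    Representation.IsIrreducible (ρ.comp f) ↔ ρ.IsIrreducible := by
  let e : Subrepresentation (ρ.comp f) ≃o Subrepresentation ρ :=
    { toFun := fun W => ⟨W.toSubmodule, fun g v hv => by
        obtain ⟨h, rfl⟩ := hf g
        exact W.apply_mem_toSubmodule h hv⟩
      invFun := fun W => ⟨W.toSubmodule, fun h v hv => W.apply_mem_toSubmodule (f h) hv⟩
      left_inv := fun _ => rfl
      right_inv := fun _ => rfl
      map_rel_iff' := Iff.rfl }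
  exact e.isSimpleOrder_iff

end IrredComp

/-! ### The involution `ι = ᵗ(·)⁻¹`, the long Weyl element, and the twist `π^ι` -/

section Twist

variable {F : Type*} [Field F] [TopologicalSpace F] {n : ℕ}
  {V : Type*} [AddCommGroup V] [Module ℂ V] {π : Representation ℂ (GL (Fin n) F) V}
  {ψ : AddChar F Circle}

/-- `g ↦ ᵗg⁻¹` is an involution of `GL_n`. [folklore] -/
theorem glTransposeInv_glTransposeInv (g : GL (Fin n) F) :
    glTransposeInv (Fin n) F (glTransposeInv (Fin n) F g) = g := by
  refine Units.ext ?_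
  rw [coe_glTransposeInv_apply, ← map_inv, coe_glTransposeInv_apply, inv_inv, transpose_transpose]

/-- `ι ∘ ι = id` as monoid homomorphisms. [folklore] -/
theorem glTransposeInv_comp_glTransposeInv :
    (glTransposeInv (Fin n) F).toMonoidHom.comp (glTransposeInv (Fin n) F).toMonoidHom =
      MonoidHom.id _ :=
  MonoidHom.ext fun g => glTransposeInv_glTransposeInv g

/-- `ᵗ(w_n)⁻¹ = w_n`: the long Weyl element is a symmetric involution
(`Matrix.transpose_permMatrix`, `weylLong_inv`). [folklore] -/
theorem glTransposeInv_weylLong : glTransposeInv (Fin n) F (weylLong n F) = weylLong n F := by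
  refine Units.ext ?_
  rw [coe_glTransposeInv_apply, weylLong_inv, coe_weylLong, Matrix.transpose_permMatrix,
    Equiv.Perm.inv_def, Fin.revPerm_symm]

variable (π) in
/-- `(π^ι)^ι = π`. [folklore] -/
theorem comp_glTransposeInv_comp_glTransposeInv :
    (π.comp (glTransposeInv (Fin n) F).toMonoidHom).comp (glTransposeInv (Fin n) F).toMonoidHom
      = π := by
  rw [MonoidHom.comp_assoc, glTransposeInv_comp_glTransposeInv, MonoidHom.comp_id]

omit [TopologicalSpace F] in
variable (π) in
/-- `(Λ ∘ π(w_n)) ∘ π(w_n) = Λ` (`w_n² = 1`). [folklore] -/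
theorem comp_weylLong_comp_weylLong (Λ : Module.Dual ℂ V) :
    (Λ.comp (π (weylLong n F))).comp (π (weylLong n F)) = Λ := by
  rw [LinearMap.comp_assoc, ← Module.End.mul_eq_comp, ← map_mul, weylLong_mul_self, map_one]
  rfl

/-- **Whittaker functionals of the twist.** If `Λ ∈ Hom_{U_n}(π, ψ_U)` then
`Λ ∘ π(w_n) ∈ Hom_{U_n}(π^ι, ψ⁻¹_U)`: for `u ∈ U_n`, `w_n ᵗu⁻¹ = (w_n ᵗu⁻¹ w_n) w_n` with
`w_n ᵗu⁻¹ w_n ∈ U_n` of character `ψ_U(w_n ᵗu⁻¹ w_n) = ψ⁻¹_U(u)` (`whittakerCharFun_weylLong_conj`).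
(Jacquet–Piatetski-Shapiro–Shalika 1983, §2 (2.1); Cogdell, §2.2.)
[cite: JacquetPiatetskiShapiroShalika1983, §2 eq. (2.1)] -/
theorem comp_weylLong_mem_whittakerFunctionals_twist {Λ : Module.Dual ℂ V}
    (hΛ : Λ ∈ whittakerFunctionals π ψ) :
    Λ.comp (π (weylLong n F)) ∈
      whittakerFunctionals (π.comp (glTransposeInv (Fin n) F).toMonoidHom) ψ⁻¹ := by
  intro u v
  have hk := weylLong_mul_glTransposeInv_mul_weylLong_mem (R := F) u.2
  have h1 : weylLong n F * glTransposeInv (Fin n) F (u : GL (Fin n) F) =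
      (weylLong n F * glTransposeInv (Fin n) F u * weylLong n F) * weylLong n F := by
    rw [mul_assoc _ (weylLong n F) (weylLong n F), weylLong_mul_self, mul_one]
  simp only [LinearMap.coe_comp, Function.comp_apply, MonoidHom.coe_comp,
    ContinuousMonoidHom.coe_toMonoidHom, MonoidHom.coe_coe]
  rw [← Module.End.mul_apply, ← map_mul, h1, map_mul, Module.End.mul_apply,
    hΛ ⟨_, hk⟩, whittakerCharFun_weylLong_conj]

/-- Conversely, `M ∈ Hom_{U_n}(π^ι, ψ⁻¹_U)` gives `M ∘ π(w_n) ∈ Hom_{U_n}(π, ψ_U)` (the previous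
lemma for `π^ι`, `ψ⁻¹`, with `(π^ι)^ι = π`, `ψ⁻¹⁻¹ = ψ`, `ι(w_n) = w_n`). [folklore] -/
theorem comp_weylLong_mem_whittakerFunctionals_of_twist {M : Module.Dual ℂ V}
    (hM : M ∈ whittakerFunctionals (π.comp (glTransposeInv (Fin n) F).toMonoidHom) ψ⁻¹) :
    M.comp (π (weylLong n F)) ∈ whittakerFunctionals π ψ := by
  have h := comp_weylLong_mem_whittakerFunctionals_twist hM
  rw [comp_glTransposeInv_comp_glTransposeInv, inv_inv] at h
  simpa [glTransposeInv_weylLong] using h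

/-- **`W̃` is a Whittaker function of the twist**: `W̃_{Λ,v} = W^{π^ι}_{Λ ∘ π(w_n), v}`, i.e.
`tildeFn (whittakerModel π Λ v) = whittakerModel π^ι (Λ ∘ π(w_n)) v` (definitional
bookkeeping: `W̃_{Λ,v}(g) = Λ(π(w_n) π(ᵗg⁻¹) v)`). [folklore] -/
theorem tildeFn_whittakerModel (Λ : Module.Dual ℂ V) (v : V) :
    tildeFn (whittakerModel π Λ v) =
      whittakerModel (π.comp (glTransposeInv (Fin n) F).toMonoidHom) (Λ.comp (π (weylLong n F)))
        v := by
  funext g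
  simp [tildeFn_apply, map_mul]

/-- Right translates: `ρ(h) W̃_{Λ,v} = W^{π^ι}_{Λ ∘ π(w_n), π(ᵗh⁻¹) v}`. [folklore] -/
theorem tildeFn_whittakerModel_mul (Λ : Module.Dual ℂ V) (v : V) (h : GL (Fin n) F) :
    (fun g => tildeFn (whittakerModel π Λ v) (g * h)) =
      whittakerModel (π.comp (glTransposeInv (Fin n) F).toMonoidHom) (Λ.comp (π (weylLong n F)))
        (π (glTransposeInv (Fin n) F h) v) := by
  funext g
  simp [tildeFn_apply, map_mul]

/-- **Genericity of the twist**: if `π` is `ψ`-generic then `π^ι` is `ψ⁻¹`-generic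
(`Λ ↦ Λ ∘ π(w_n)` is injective, `π(w_n)` being an involution). [folklore] -/
theorem IsGeneric.twist (h : IsGeneric π ψ) :
    IsGeneric (π.comp (glTransposeInv (Fin n) F).toMonoidHom) ψ⁻¹ := by
  rw [isGeneric_iff] at h ⊢
  obtain ⟨Λ, hΛ, hΛ0⟩ := h
  refine ⟨Λ.comp (π (weylLong n F)), comp_weylLong_mem_whittakerFunctionals_twist hΛ,
    fun h0 => hΛ0 ?_⟩
  rw [← comp_weylLong_comp_weylLong π Λ, h0, LinearMap.zero_comp]

/-- `π^ι` is irreducible iff `π` is (`ι` is a bijection of `GL_n(F)`). [folklore] -/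
theorem isIrreducible_twist_iff :
    Representation.IsIrreducible (π.comp (glTransposeInv (Fin n) F).toMonoidHom) ↔
      π.IsIrreducible :=
  isIrreducible_comp_iff π _ (Function.Involutive.surjective glTransposeInv_glTransposeInv)

/-- Smoothness passes to the twist `π^ι`: the stabiliser of `v` under `π^ι` is the preimage of
its stabiliser under `π` by the continuous map `ι`. [folklore] -/
theorem isSmooth_twist (hπ : π.IsSmooth) :
    Representation.IsSmooth (π.comp (glTransposeInv (Fin n) F).toMonoidHom) := by
  intro v
  have hset : ((Representation.stabilizerSubgroup (π.comp (glTransposeInv (Fin n) F).toMonoidHom)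
      v : Subgroup (GL (Fin n) F)) : Set (GL (Fin n) F)) =
      glTransposeInv (Fin n) F ⁻¹' (π.stabilizerSubgroup v : Set (GL (Fin n) F)) := by
    ext g
    simp [Representation.mem_stabilizerSubgroup]
  rw [Representation.isSmoothVector_iff, hset]
  exact (hπ v).preimage (map_continuous _)

/-- `K`-fixed vectors of the twist: `V^{K}(π^ι) = V^{ι(K)}(π)`. [folklore] -/
theorem fixedPoints_twist (K : Subgroup (GL (Fin n) F)) :
    Representation.fixedPoints (π.comp (glTransposeInv (Fin n) F).toMonoidHom) K =
      π.fixedPoints (K.map (glTransposeInv (Fin n) F).toMonoidHom) := by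
  ext v
  simp only [Representation.mem_fixedPoints, Subgroup.mem_map, forall_exists_index, and_imp,
    forall_apply_eq_imp_iff₂, MonoidHom.coe_comp, Function.comp_apply]

/-- Admissibility passes to the twist `π^ι`: for a compact open `K`, `V^K(π^ι) = V^{ι(K)}(π)`
with `ι(K) = ι⁻¹(K)` again compact open. [folklore] -/
theorem isAdmissible_twist (hπ : π.IsAdmissible) :
    Representation.IsAdmissible (π.comp (glTransposeInv (Fin n) F).toMonoidHom) := by
  refine ⟨isSmooth_twist hπ.isSmooth, fun K hK => ?_⟩
  set L : Subgroup (GL (Fin n) F) :=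
    (K : Subgroup (GL (Fin n) F)).map (glTransposeInv (Fin n) F).toMonoidHom with hL
  have hLset : (L : Set (GL (Fin n) F)) =
      glTransposeInv (Fin n) F ⁻¹' (K : Set (GL (Fin n) F)) := by
    rw [hL, Subgroup.coe_map]
    exact congrFun (Set.image_eq_preimage_of_inverse glTransposeInv_glTransposeInv
      glTransposeInv_glTransposeInv) _
  have hLopen : IsOpen (L : Set (GL (Fin n) F)) := by
    rw [hLset]
    exact K.isOpen.preimage (map_continuous _)
  have hLcpt : IsCompact (L : Set (GL (Fin n) F)) := by
    rw [hL, Subgroup.coe_map]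
    exact hK.image (map_continuous (glTransposeInv (Fin n) F))
  have h := hπ.2 ⟨L, hLopen⟩ hLcpt
  rw [fixedPoints_twist]
  exact h

end Twist

/-! ### Transport of the tilde span and the reduction of `hasRSEpsilon_ne_zero` -/

section Span

variable {F : Type*} [Field F] [ValuativeRel F] [TopologicalSpace F]
  [IsNonarchimedeanLocalField F] {n m : ℕ}
  {V : Type*} [AddCommGroup V] [Module ℂ V] {V' : Type*} [AddCommGroup V'] [Module ℂ V']
  {hmn : m < n} {π : Representation ℂ (GL (Fin n) F) V} {π' : Representation ℂ (GL (Fin m) F) V'}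
  {ψ : AddChar F Circle}
  [MeasurableSpace (GL (Fin m) F ⧸ upperUnitriangular (Fin m) F)]
  {ν : Measure (GL (Fin m) F ⧸ upperUnitriangular (Fin m) F)}
  [MeasurableSpace F] {μ : Measure F}

/-- **Transport of the span along `W ↦ ρ(w_{n,m}) W̃`.** A finite combination
`∑ Q_i Ψ_{n-m-1}(s; W_i, W'_i) = P(q^{-s})⁻¹` of `j = n - m - 1` integrals of Whittaker functions
`W_i` of `(π^ι, ψ⁻¹)`, `W'_i` of `(π'^ι, ψ)` is literally a combination of the tilde integrals
`Ψ̃(s; ρ(w_{n,m}) W̃, W̃')` of `(π, π', ψ)` entering `HasRSGamma`: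
`W^{π^ι}_{M,u} = ρ(w_{n,m}) W̃_{M∘π(w_n), π(ᵗw_{n,m}) u}` and `W^{π'^ι}_{M',u'} = W̃'_{M'∘π'(w_m), u'}`
(`tildeFn_whittakerModel_mul`, `tildeFn_whittakerModel`, `w² = 1`), with
`M ∘ π(w_n) ∈ Hom_U(π, ψ)`, `M' ∘ π'(w_m) ∈ Hom_U(π', ψ⁻¹)`
(`comp_weylLong_mem_whittakerFunctionals_of_twist`). (JPSS 1983, §2 (2.1).)
[cite: JacquetPiatetskiShapiroShalika1983, §2 eq. (2.1)] -/
theorem tilde_span_of_twist_span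
    (h : ∃ (P : ℂ[X]) (k : ℕ) (M : Fin k → Module.Dual ℂ V) (M' : Fin k → Module.Dual ℂ V')
      (u : Fin k → V) (u' : Fin k → V') (Q : Fin k → RatFunc ℂ),
      P.eval 0 ≠ 0 ∧
      (∀ i, M i ∈ whittakerFunctionals (π.comp (glTransposeInv (Fin n) F).toMonoidHom) ψ⁻¹) ∧
      (∀ i, M' i ∈ whittakerFunctionals (π'.comp (glTransposeInv (Fin m) F).toMonoidHom) ψ⁻¹⁻¹) ∧
      EqOnRightHalfPlane (residueFieldCard F)
        (fun s => ∑ i, evalAtQ (residueFieldCard F) (Q i) s *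
          rsZetaTilde hmn μ ν
            (whittakerModel (π.comp (glTransposeInv (Fin n) F).toMonoidHom) (M i) (u i))
            (whittakerModel (π'.comp (glTransposeInv (Fin m) F).toMonoidHom) (M' i) (u' i)) s)
        (rsLRat P)) :
    ∃ (P : ℂ[X]) (k : ℕ) (Λ : Fin k → Module.Dual ℂ V) (Λ' : Fin k → Module.Dual ℂ V')
      (v : Fin k → V) (v' : Fin k → V') (Q : Fin k → RatFunc ℂ),
      P.eval 0 ≠ 0 ∧ (∀ i, Λ i ∈ whittakerFunctionals π ψ) ∧
      (∀ i, Λ' i ∈ whittakerFunctionals π' ψ⁻¹) ∧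
      EqOnRightHalfPlane (residueFieldCard F)
        (fun s => ∑ i, evalAtQ (residueFieldCard F) (Q i) s *
          rsZetaTilde hmn μ ν
            (fun g => tildeFn (whittakerModel π (Λ i) (v i)) (g * weylNM F hmn.le))
            (tildeFn (whittakerModel π' (Λ' i) (v' i))) s)
        (rsLRat P) := by
  obtain ⟨P, k, M, M', u, u', Q, hP, hM, hM', hEq⟩ := h
  refine ⟨P, k, fun i => (M i).comp (π (weylLong n F)), fun i => (M' i).comp (π' (weylLong m F)),
    fun i => π (glTransposeInv (Fin n) F (weylNM F hmn.le))⁻¹ (u i), u', Q, hP,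
    fun i => comp_weylLong_mem_whittakerFunctionals_of_twist (hM i),
    fun i => comp_weylLong_mem_whittakerFunctionals_of_twist (hM' i), ?_⟩
  have e1 : ∀ i, (fun g => tildeFn (whittakerModel π ((M i).comp (π (weylLong n F)))
      (π (glTransposeInv (Fin n) F (weylNM F hmn.le))⁻¹ (u i))) (g * weylNM F hmn.le)) =
      whittakerModel (π.comp (glTransposeInv (Fin n) F).toMonoidHom) (M i) (u i) := fun i => by
    rw [tildeFn_whittakerModel_mul, comp_weylLong_comp_weylLong, ← Module.End.mul_apply,
      ← map_mul, mul_inv_cancel, map_one, Module.End.one_apply]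
  have e2 : ∀ i, tildeFn (whittakerModel π' ((M' i).comp (π' (weylLong m F))) (u' i)) =
      whittakerModel (π'.comp (glTransposeInv (Fin m) F).toMonoidHom) (M' i) (u' i) := fun i => by
    rw [tildeFn_whittakerModel, comp_weylLong_comp_weylLong]
  simp only [e1, e2]
  exact hEq

/-- **`hasRSEpsilon_ne_zero` from JPSS Thm. 2.7 (ii) at `j = n - m - 1` for the twists.** The
named fact `hasRSEpsilon_ne_zero` at `(μ, ν)` holds as soon as, for the (again irreducible,
admissible, `ψ⁻¹`/`ψ`-generic: `isIrreducible_twist_iff`, `isAdmissible_twist`,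
`IsGeneric.twist`, `AddChar.IsContinuousNontrivial.inv`) twists `π^ι`, `π'^ι`, some finite
`ℂ(q^{-s})`-combination of their `Ψ_{n-m-1}` integrals at `(μ, ν)` equals `P(q^{-s})⁻¹`,
`P(0) ≠ 0`, on a right half-plane ("the `Ψ_{n-m-1}` span a non-zero fractional ideal",
Jacquet–Piatetski-Shapiro–Shalika 1983, Thm. 2.7 (ii); Cogdell, §3.1, Thm. 3.1) — the hypothesis
`h`, stated in the binder form of the named facts of `RankinSelbergLocal` for `(π^ι, π'^ι, ψ⁻¹)`.
Relies on `tilde_span_of_twist_span` and `hasRSEpsilon_ne_zero_of_tilde_span`.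
[cite: JacquetPiatetskiShapiroShalika1983, Thm. 2.7 (ii)–(iii)] -/
theorem hasRSEpsilon_ne_zero_of_twist_span
    (h : ∀ [Representation.IsIrreducible (π.comp (glTransposeInv (Fin n) F).toMonoidHom)]
      [Representation.IsIrreducible (π'.comp (glTransposeInv (Fin m) F).toMonoidHom)],
      Representation.IsAdmissible (π.comp (glTransposeInv (Fin n) F).toMonoidHom) →
      Representation.IsAdmissible (π'.comp (glTransposeInv (Fin m) F).toMonoidHom) →
      IsGeneric (π.comp (glTransposeInv (Fin n) F).toMonoidHom) ψ⁻¹ →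
      IsGeneric (π'.comp (glTransposeInv (Fin m) F).toMonoidHom) ψ⁻¹⁻¹ →
      ψ⁻¹.IsContinuousNontrivial →
      ∃ (P : ℂ[X]) (k : ℕ) (M : Fin k → Module.Dual ℂ V) (M' : Fin k → Module.Dual ℂ V')
        (u : Fin k → V) (u' : Fin k → V') (Q : Fin k → RatFunc ℂ),
        P.eval 0 ≠ 0 ∧
        (∀ i, M i ∈ whittakerFunctionals (π.comp (glTransposeInv (Fin n) F).toMonoidHom) ψ⁻¹) ∧
        (∀ i, M' i ∈
          whittakerFunctionals (π'.comp (glTransposeInv (Fin m) F).toMonoidHom) ψ⁻¹⁻¹) ∧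
        EqOnRightHalfPlane (residueFieldCard F)
          (fun s => ∑ i, evalAtQ (residueFieldCard F) (Q i) s *
            rsZetaTilde hmn μ ν
              (whittakerModel (π.comp (glTransposeInv (Fin n) F).toMonoidHom) (M i) (u i))
              (whittakerModel (π'.comp (glTransposeInv (Fin m) F).toMonoidHom) (M' i) (u' i)) s)
          (rsLRat P)) :
    hasRSEpsilon_ne_zero (hmn := hmn) (π := π) (π' := π') (ψ := ψ) (ν := ν) (μ := μ) := by
  refine hasRSEpsilon_ne_zero_of_tilde_span fun hπ hπ' hg hg' hψ => ?_
  haveI : Representation.IsIrreducible (π.comp (glTransposeInv (Fin n) F).toMonoidHom) :=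
    isIrreducible_twist_iff.mpr ‹_›
  haveI : Representation.IsIrreducible (π'.comp (glTransposeInv (Fin m) F).toMonoidHom) :=
    isIrreducible_twist_iff.mpr ‹_›
  exact tilde_span_of_twist_span
    (h (isAdmissible_twist hπ) (isAdmissible_twist hπ') hg.twist hg'.twist hψ.inv)

end Span

end Literature.NumberTheory.Automorphic
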